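/-
Copyright (c) 2026 the pub-hodgecm-mathlib formalisation cell (harness21).  Prover seat hodgecm-mathlib-K2Liu-p08 (g3): Track B «K2-LIT»,
hLiu418 = stmt-HodgeConjecture-24832; LEAD F0P6-plan (g13) RULINGS «M-157n» (#42S-S5 cut) and «M-157o» 2026-09-04T09:30:19Z (road (d), mechanism
(iii) «`E^{(1)}(0,φ) = E_P(0,φ) = φ₀ + M(0)φ₀ ∈ I₁(0)`»), file F1b (β: the transport to the centre).
-/
import Literature.NumberTheory.K2Lit.SiegelEisensteinSeriesDoubled      -- ★ `IsSiegelDeltaSection`, `siegelDeltaCharacter`, `modDelta_pos`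
import Mathlib.Analysis.SpecialFunctions.Pow.Deriv
import Mathlib.Analysis.Complex.CauchyIntegral
import Mathlib.Analysis.Analytic.Uniqueness
import HarnessLib

/-!
# Crux `HLiu418`, road `K2_Liu`, #42S-S5 «incoherent pieces die», file F1b (β):
# THE CONTINUED INTERTWINED FAMILY STAYS IN `I(−s, χ′)`, AND `E_P(0, φ) ∈ I₁(0)` AT THE CENTRE — transport by the identity theorem

Cell `hodgecm-mathlib`, crux item hLiu418 = `stmt-HodgeConjecture-24832`; squad K2 ∕ K2Liu; prover K2Liu-p08 (g3).  THEOREMS ONLY (no `def`, no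
instance, no notation, no named-fact hypothesis, no `sorry`); lane `--supports stmt-HodgeConjecture-24832 --as helper` (count-neutral helper).
HYPOTHESIS-FIRST and GENERIC in `n`: the doubled Siegel frame `H(𝔸) = HA L e dV hdV dW hdW` of the tree (★ `K2Lit/SiegelEisensteinSeriesDoubled`:
`IsSiegelDeltaSection χ s F : F(p h) = δ_{χ,s}(p) F(h)` on `P_Δ(𝔸)`, `δ_{χ,s}(p) = siegelDeltaCharacter χ s p = χ(det_Δ p)|det_Δ p|^{s + n∕2}`).

THE POINT (RULING M-157o (iii), road (d) with the INHERITED continuation, K2Liu-p01 (g7) S5-W3 census (V2)(i)).  On Godement's half-plane the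
constant term of the Siegel Eisenstein series along `N_Δ` is `CT(E(s)) = a(s)·f_s + M(s)f_s` (★ `K2LiuConstantTermDelta.constTerm_three_cells`; at `n = 1`
the middle cell is empty) with `f_s ∈ I(s, χ)` and `M(s)f_s ∈ I(−s, χ′)`.  Given ANY holomorphic continuation `C(s)` of the constant term to a
connected window `U` (S5-W3-a: the constant term of the continued series is holomorphic), the DIFFERENCE `M⋆(s) := C(s) − a(s)·f_s` is a holomorphic
continuation of `M(s)f_s`, and the section law `M⋆(s)(p h) = δ_{χ′,−s}(p) M⋆(s)(h)` — an identity between two holomorphic functions of `s` for each fixed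
`(p, h)` — propagates from the half-plane to all of `U` by the identity theorem.  At the centre `s = 0 ∈ U`, where `δ_{χ′,−0} = δ_{χ,0}` (e.g. `χ′ = χ`),
`C(0) = a(0)·f₀ + M⋆(0) ∈ I(0, χ)`: this is «`E_P(0, φ) = φ₀ + M(0)φ₀ ∈ I₁(0)`», the input of ★ S5-W4 `K2LiuSingularSectionVanishes`.
NOTHING about the intertwining integral itself is used: its half-plane section law enters as the hypothesis `hM` (local twin ★ Φ8a
`isLocalSiegelSection_localIntertwining_of_modulus`; the global statement is F1b-α of the census), so this file is option-independent bookkeeping.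

CONTENTS.
* §1 `eqOn_of_preconnected_of_eqOn_open` ∕ `…_inter_halfPlane`: identity principle on an open preconnected `U` from agreement on `U ∩ V`, `V` open,
  `U ∩ V ≠ ∅` (Mathlib `AnalyticOnNhd.eqOn_of_preconnected_of_eventuallyEq`; generalises ★ `K2LiuEisensteinContinuationGlue.eqOn_of_eqOn_halfPlane`'s slit
  half-plane to any window).
* §2 `differentiable_siegelDeltaCharacter`: `s ↦ δ_{χ,s}(p)` is entire (`modDelta p > 0`).
* §3 **`isSiegelDeltaSection_of_eqOn_open`**: a family `G : ℂ → H(𝔸) → ℂ`, holomorphic on `U` in `s` for each `h`, which is a section of `I(σ(s), χ)` for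
  `s ∈ U ∩ V` (`σ` any holomorphic reparametrisation, e.g. `s ↦ −s`), is a section of `I(σ(s), χ)` for EVERY `s ∈ U`.
* §4 **`isSiegelDeltaSection_constTerm_sub`** (THE (iii) SHAPE): `C = a·f + M` on `U ∩ V` with `M(s) ∈ I(−s, χ′)` there, `C, a, f` holomorphic on `U` ⇒
  `C(s) − a(s)·f_s ∈ I(−s, χ′)` for all `s ∈ U`; **`isSiegelDeltaSection_constTerm_centre`**: at `s = 0 ∈ U`, if `f₀ ∈ I(0, χ)` and `δ_{χ′,0} = δ_{χ,0}` on
  `P_Δ(𝔸)`, then `C(0) ∈ I(0, χ)`; `…_centre_self` is the case `χ′ = χ`.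
* §5 CUT (B) «CENTRAL RAY» (LEAD F0P6-plan (g13) 09:52:40Z, of record for S5): the same transport for a RAY EIGEN-LAW `G s (m h) = κ(s) G s h` at a fixed
  `m ∈ H(𝔸)` (`apply_mul_eq_of_eqOn_halfPlane`, `constTerm_sub_apply_mul_eq`, `constTerm_centre_eq_add_of_rayEigen`) — what ★ S5-W4's proof really uses is
  only the central scalar Levi element `m(z(2)·1)`, whose eigenvalue on `M(s)f_s` is F1b-ray `K2LiuIntertwiningCentralRayEigen`.
HONEST LABEL.  `HC_CM` is proved only modulo the 7 printed citations (2 remaining named inputs: hLiu418 = `stmt-HodgeConjecture-24832`,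
h413 = `stmt-HodgeConjecture-24833`) until rung 0 closes.

## References
* [MoeglinWaldspurger1995] C. Mœglin, J.-L. Waldspurger, *Spectral decomposition and Eisenstein series* (1995), II.1.7 (constant terms of Eisenstein
  series: `E_P = Σ_w M(w,s)φ`), IV.1.9–IV.1.11 (the continued constant term is the constant term of the continuation; holomorphy).
* [KudlaRallis1994] S. Kudla, S. Rallis, *A regularized Siegel–Weil formula: the first term identity*, Ann. of Math. 140 (1994), §1 (`E_P(s) = Φ_s + M(s)Φ_s`).
* [JiangWu2016ChiB] D. Jiang, C. Wu, J. Number Theory 161 (2016), Prop. 4.1 (the incoherence mechanism of road (d)).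
-/

set_option autoImplicit false
set_option linter.dupNamespace false -- the mandated namespace repeats `HodgeConjecture.HodgeConjecture`

noncomputable section

open Set Filter Topology
open NumberField IsDedekindDomain

namespace Summit.HodgeConjecture.HodgeConjecture.Cruxes.HLiu418.K2LiuRankOneCentreContinuation

open Literature.NumberTheory.GaloisRepresentations
open Literature.NumberTheory.GelbartRogawski1991 Literature.NumberTheory.GelbartRogawski1991.GRConstruction
open Literature.NumberTheory.K2Lit.SiegelDoubled

/-! ## §1 The identity principle on a window -/

/-- **identity principle on a window**: two functions holomorphic on an open preconnected `U ⊆ ℂ` that agree on `U ∩ V` for an open `V` meeting `U`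
agree on `U`.  [cite: MoeglinWaldspurger1995, IV.1.9] -/
theorem eqOn_of_preconnected_of_eqOn_open {U V : Set ℂ} (hU : IsOpen U) (hUc : IsPreconnected U) (hV : IsOpen V) (hne : (U ∩ V).Nonempty)
    {g₁ g₂ : ℂ → ℂ} (h₁ : DifferentiableOn ℂ g₁ U) (h₂ : DifferentiableOn ℂ g₂ U) (h : ∀ s ∈ U, s ∈ V → g₁ s = g₂ s) : EqOn g₁ g₂ U := by
  obtain ⟨z₀, hz₀U, hz₀V⟩ := hne
  refine (h₁.analyticOnNhd hU).eqOn_of_preconnected_of_eventuallyEq (h₂.analyticOnNhd hU) hUc hz₀U ?_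
  filter_upwards [hU.mem_nhds hz₀U, hV.mem_nhds hz₀V] with s hsU hsV
  exact h s hsU hsV

/-- **identity principle from a half-plane**: holomorphic on an open preconnected window `U` meeting `{c < Re s}` and equal there ⇒ equal on `U`
(the shape in which Godement-range identities are continued).  [cite: MoeglinWaldspurger1995, IV.1.9] -/
theorem eqOn_of_preconnected_of_eqOn_inter_halfPlane {U : Set ℂ} (hU : IsOpen U) (hUc : IsPreconnected U) {c : ℝ}
    (hne : (U ∩ {s : ℂ | c < s.re}).Nonempty) {g₁ g₂ : ℂ → ℂ} (h₁ : DifferentiableOn ℂ g₁ U) (h₂ : DifferentiableOn ℂ g₂ U)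
    (h : ∀ s ∈ U, c < s.re → g₁ s = g₂ s) : EqOn g₁ g₂ U :=
  eqOn_of_preconnected_of_eqOn_open hU hUc (isOpen_lt continuous_const Complex.continuous_re) hne h₁ h₂ fun s hs hsV => h s hs hsV

/-! ## §2 The inducing character is entire in `s` -/

section Doubled

variable (L : Type) [Field L] [NumberField L] [IsCMField L]
variable {N M n : ℕ} (e : Fin N × Fin M ≃ Fin n)
  (dV : Fin N → L) (hdV : ∀ i, IsCMField.complexConj L (dV i) = dV i)
  (dW : Fin M → L) (hdW : ∀ i, IsCMField.complexConj L (dW i) = dW i)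

/-- **`s ↦ δ_{χ,s}(p) = χ(det_Δ p)·|det_Δ p|^{s+n∕2}` is entire** (a constant times `m^{2s+n}` with `m = modDelta p > 0`).  [cite: KudlaRallis1994, §1] -/
theorem differentiable_siegelDeltaCharacter (χ : HeckeCharacter L) (p : HA L e dV hdV dW hdW) :
    Differentiable ℂ fun s : ℂ => siegelDeltaCharacter L e dV hdV dW hdW χ s p := by
  unfold siegelDeltaCharacter
  refine (differentiable_const _).mul (Differentiable.const_cpow ?_ (Or.inl ?_))
  · exact (differentiable_id.const_mul _).add_const _
  · exact_mod_cast (modDelta_pos L e dV hdV dW hdW p).ne'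

/-- … and so is `s ↦ δ_{χ,σ(s)}(p)` for a holomorphic reparametrisation `σ` (e.g. `σ s = −s`). [cite: KudlaRallis1994, §1] -/
theorem differentiable_siegelDeltaCharacter_comp (χ : HeckeCharacter L) (p : HA L e dV hdV dW hdW) {σ : ℂ → ℂ} (hσ : Differentiable ℂ σ) :
    Differentiable ℂ fun s : ℂ => siegelDeltaCharacter L e dV hdV dW hdW χ (σ s) p :=
  (differentiable_siegelDeltaCharacter L e dV hdV dW hdW χ p).comp hσ

/-! ## §3 Transport of the section law along a holomorphic family -/

/-- **THE SECTION LAW PROPAGATES.**  Let `U ⊆ ℂ` be open and preconnected, `V` open with `U ∩ V ≠ ∅`, `σ` holomorphic, and `G : ℂ → H(𝔸) → ℂ` a family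
with `s ↦ G s h` holomorphic on `U` for every `h`.  If `G s` is a section of `I(σ s, χ)` for all `s ∈ U ∩ V`, then `G s` is a section of `I(σ s, χ)` for
ALL `s ∈ U` (for fixed `p ∈ P_Δ(𝔸)` and `h`, both sides of `G s (p h) = δ_{χ,σ s}(p) G s h` are holomorphic in `s`).
[cite: MoeglinWaldspurger1995, IV.1.9–IV.1.11] -/
theorem isSiegelDeltaSection_of_eqOn_open {U V : Set ℂ} (hU : IsOpen U) (hUc : IsPreconnected U) (hV : IsOpen V) (hne : (U ∩ V).Nonempty)
    (χ : HeckeCharacter L) {σ : ℂ → ℂ} (hσ : Differentiable ℂ σ) {G : ℂ → HA L e dV hdV dW hdW → ℂ}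
    (hG : ∀ h, DifferentiableOn ℂ (fun s => G s h) U)
    (hsec : ∀ s ∈ U, s ∈ V → IsSiegelDeltaSection L e dV hdV dW hdW χ (σ s) (G s)) :
    ∀ s ∈ U, IsSiegelDeltaSection L e dV hdV dW hdW χ (σ s) (G s) := by
  intro s hs p hp h
  have h₂ : DifferentiableOn ℂ (fun t => siegelDeltaCharacter L e dV hdV dW hdW χ (σ t) p * G t h) U :=
    (differentiable_siegelDeltaCharacter_comp L e dV hdV dW hdW χ p hσ).differentiableOn.mul (hG h)
  exact eqOn_of_preconnected_of_eqOn_open hU hUc hV hne (hG (p * h)) h₂ (fun t ht htV => hsec t ht htV p hp h) hs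

/-- half-plane form of `isSiegelDeltaSection_of_eqOn_open` (`V = {c < Re s}`, Godement's range). [cite: MoeglinWaldspurger1995, IV.1.9–IV.1.11] -/
theorem isSiegelDeltaSection_of_eqOn_halfPlane {U : Set ℂ} (hU : IsOpen U) (hUc : IsPreconnected U) {c : ℝ}
    (hne : (U ∩ {s : ℂ | c < s.re}).Nonempty) (χ : HeckeCharacter L) {σ : ℂ → ℂ} (hσ : Differentiable ℂ σ)
    {G : ℂ → HA L e dV hdV dW hdW → ℂ} (hG : ∀ h, DifferentiableOn ℂ (fun s => G s h) U)
    (hsec : ∀ s ∈ U, c < s.re → IsSiegelDeltaSection L e dV hdV dW hdW χ (σ s) (G s)) :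
    ∀ s ∈ U, IsSiegelDeltaSection L e dV hdV dW hdW χ (σ s) (G s) :=
  isSiegelDeltaSection_of_eqOn_open L e dV hdV dW hdW hU hUc (isOpen_lt continuous_const Complex.continuous_re) hne χ hσ hG
    fun s hs hsV => hsec s hs hsV

/-! ## §4 The (iii) shape: `M⋆(s) := C(s) − a(s)·f_s ∈ I(−s, χ′)` on the window, and `C(0) ∈ I(0, χ)` at the centre -/

/-- **`M(s)φ_s` CONTINUED TO THE WINDOW AS A HOLOMORPHIC `I(−s, χ′)`-VALUED FAMILY.**  Let `U` be an open preconnected window meeting Godement's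
half-plane `{c < Re s}`; `C, f : ℂ → H(𝔸) → ℂ` and `a : ℂ → ℂ` holomorphic on `U` (in `s`, for each `h`); suppose on `U ∩ {c < Re s}` the
CONSTANT-TERM DECOMPOSITION `C(s)(h) = a(s)·f_s(h) + M(s)(h)` holds with `M(s)` a section of `I(−s, χ′)` (★ `constTerm_three_cells` + the half-plane
section law of the intertwining integral).  Then `M⋆(s) := C(s) − a(s)·f_s` — which equals `M(s)` on the half-plane and is holomorphic on `U` — is a
section of `I(−s, χ′)` for EVERY `s ∈ U`.  [cite: MoeglinWaldspurger1995, II.1.7, IV.1.9–IV.1.11] [cite: KudlaRallis1994, §1] -/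
theorem isSiegelDeltaSection_constTerm_sub {U : Set ℂ} (hU : IsOpen U) (hUc : IsPreconnected U) {c : ℝ}
    (hne : (U ∩ {s : ℂ | c < s.re}).Nonempty) (χ' : HeckeCharacter L)
    {C f M : ℂ → HA L e dV hdV dW hdW → ℂ} {a : ℂ → ℂ}
    (hC : ∀ h, DifferentiableOn ℂ (fun s => C s h) U) (hf : ∀ h, DifferentiableOn ℂ (fun s => f s h) U) (ha : DifferentiableOn ℂ a U)
    (hdec : ∀ s ∈ U, c < s.re → ∀ h, C s h = a s * f s h + M s h)
    (hM : ∀ s ∈ U, c < s.re → IsSiegelDeltaSection L e dV hdV dW hdW χ' (-s) (M s)) :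
    ∀ s ∈ U, IsSiegelDeltaSection L e dV hdV dW hdW χ' (-s) (fun h => C s h - a s * f s h) := by
  refine isSiegelDeltaSection_of_eqOn_halfPlane L e dV hdV dW hdW hU hUc hne χ' differentiable_neg
    (G := fun s h => C s h - a s * f s h) (fun h => (hC h).sub (ha.mul (hf h))) ?_
  intro s hs hsV
  have hMs : (fun h => C s h - a s * f s h) = M s := funext fun h => by rw [hdec s hs hsV h, add_sub_cancel_left]
  rw [hMs]
  exact hM s hs hsV

/-- the continued intertwined family AGREES with `M(s)` on the half-plane (so `M⋆` is «the» continuation). [cite: MoeglinWaldspurger1995, IV.1.9] -/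
theorem constTerm_sub_eq_of_mem_halfPlane {U : Set ℂ} {c : ℝ} {C f M : ℂ → HA L e dV hdV dW hdW → ℂ} {a : ℂ → ℂ}
    (hdec : ∀ s ∈ U, c < s.re → ∀ h, C s h = a s * f s h + M s h) {s : ℂ} (hs : s ∈ U) (hsc : c < s.re) :
    (fun h => C s h - a s * f s h) = M s :=
  funext fun h => by rw [hdec s hs hsc h, add_sub_cancel_left]

/-- **`E_P(0, φ) ∈ I₁(0)` AT THE CENTRE.**  In the setting of `isSiegelDeltaSection_constTerm_sub`, if moreover `0 ∈ U`, `f₀ ∈ I(0, χ)` and the two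
inducing characters agree at the centre (`δ_{χ′,0} = δ_{χ,0}` on `P_Δ(𝔸)` — automatic for `χ′ = χ`, and the meaning of «`I(0,χ) = I(−0,χ′)`»), then the
continued constant term at the centre `C(0) = a(0)·f₀ + M⋆(0)` is a section of `I(0, χ)` — the hypothesis `hF` of ★ S5-W4
`K2LiuSingularSectionVanishes.eq_zero_of_isSiegelDeltaSection_of_ratH`.  [cite: MoeglinWaldspurger1995, II.1.7] [cite: KudlaRallis1994, §1] [cite: JiangWu2016ChiB, Prop. 4.1] -/
theorem isSiegelDeltaSection_constTerm_centre {U : Set ℂ} (hU : IsOpen U) (hUc : IsPreconnected U) {c : ℝ}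
    (hne : (U ∩ {s : ℂ | c < s.re}).Nonempty) (h0 : (0 : ℂ) ∈ U) (χ χ' : HeckeCharacter L)
    {C f M : ℂ → HA L e dV hdV dW hdW → ℂ} {a : ℂ → ℂ}
    (hC : ∀ h, DifferentiableOn ℂ (fun s => C s h) U) (hf : ∀ h, DifferentiableOn ℂ (fun s => f s h) U) (ha : DifferentiableOn ℂ a U)
    (hdec : ∀ s ∈ U, c < s.re → ∀ h, C s h = a s * f s h + M s h)
    (hM : ∀ s ∈ U, c < s.re → IsSiegelDeltaSection L e dV hdV dW hdW χ' (-s) (M s))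
    (hf0 : IsSiegelDeltaSection L e dV hdV dW hdW χ 0 (f 0))
    (hχχ' : ∀ p, IsSiegelDelta L e dV hdV dW hdW p →
      siegelDeltaCharacter L e dV hdV dW hdW χ' 0 p = siegelDeltaCharacter L e dV hdV dW hdW χ 0 p) :
    IsSiegelDeltaSection L e dV hdV dW hdW χ 0 (C 0) := by
  have hM0 := isSiegelDeltaSection_constTerm_sub L e dV hdV dW hdW hU hUc hne χ' hC hf ha hdec hM 0 h0
  intro p hp h
  have h1 := hM0 p hp h
  simp only [neg_zero] at h1
  rw [hχχ' p hp, hf0 p hp h] at h1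
  linear_combination h1

/-- **`E_P(0, φ) ∈ I₁(0)`, same character** (`χ′ = χ`): the continued constant term at the centre is a section of `I(0, χ)`.
[cite: MoeglinWaldspurger1995, II.1.7] [cite: KudlaRallis1994, §1] -/
theorem isSiegelDeltaSection_constTerm_centre_self {U : Set ℂ} (hU : IsOpen U) (hUc : IsPreconnected U) {c : ℝ}
    (hne : (U ∩ {s : ℂ | c < s.re}).Nonempty) (h0 : (0 : ℂ) ∈ U) (χ : HeckeCharacter L)
    {C f M : ℂ → HA L e dV hdV dW hdW → ℂ} {a : ℂ → ℂ}
    (hC : ∀ h, DifferentiableOn ℂ (fun s => C s h) U) (hf : ∀ h, DifferentiableOn ℂ (fun s => f s h) U) (ha : DifferentiableOn ℂ a U)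
    (hdec : ∀ s ∈ U, c < s.re → ∀ h, C s h = a s * f s h + M s h)
    (hM : ∀ s ∈ U, c < s.re → IsSiegelDeltaSection L e dV hdV dW hdW χ (-s) (M s))
    (hf0 : IsSiegelDeltaSection L e dV hdV dW hdW χ 0 (f 0)) :
    IsSiegelDeltaSection L e dV hdV dW hdW χ 0 (C 0) :=
  isSiegelDeltaSection_constTerm_centre L e dV hdV dW hdW hU hUc hne h0 χ χ hC hf ha hdec hM hf0 fun _ _ => rfl

/-! ## §5 CUT (B) of RULING M-157o∕LEAD 09:52:40Z: transport of a RAY EIGEN-LAW (only the central scalar Levi element is needed by ★ S5-W4) -/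

/-- **A RAY EIGEN-LAW PROPAGATES.**  `U` open preconnected meeting `{c < Re s}`; `G : ℂ → H(𝔸) → ℂ` holomorphic on `U` in `s` for each `h`; `m ∈ H(𝔸)`
fixed; `κ` holomorphic on `U`.  If `G s (m h) = κ(s) · G s h` for all `h` and all `s ∈ U` with `c < Re s`, then the same holds for every `s ∈ U`.
(Cut (B): `m = m(z(t)·1)` the central scalar Levi element, `κ(s) = χ(z(t))^{−n}|z(t)|^{n²∕2 − ns}` from F1b-ray.)  [cite: MoeglinWaldspurger1995, IV.1.9–IV.1.11] -/
theorem apply_mul_eq_of_eqOn_halfPlane {U : Set ℂ} (hU : IsOpen U) (hUc : IsPreconnected U) {c : ℝ}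
    (hne : (U ∩ {s : ℂ | c < s.re}).Nonempty) {G : ℂ → HA L e dV hdV dW hdW → ℂ} (hG : ∀ h, DifferentiableOn ℂ (fun s => G s h) U)
    (m : HA L e dV hdV dW hdW) {κ : ℂ → ℂ} (hκ : DifferentiableOn ℂ κ U)
    (heig : ∀ s ∈ U, c < s.re → ∀ h, G s (m * h) = κ s * G s h) :
    ∀ s ∈ U, ∀ h, G s (m * h) = κ s * G s h := by
  intro s hs h
  exact eqOn_of_preconnected_of_eqOn_inter_halfPlane hU hUc hne (hG (m * h)) (hκ.mul (hG h)) (fun t ht htc => heig t ht htc h) hs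

/-- **the continued intertwined family keeps its ray eigen-law**: with the constant-term decomposition `C = a·f + M` on the half-plane and
`M(s)(m h) = κ(s) M(s)(h)` there (`C, f, a, κ` holomorphic on the window `U`), the continuation `M⋆(s) = C(s) − a(s)·f_s` satisfies
`M⋆(s)(m h) = κ(s) M⋆(s)(h)` for EVERY `s ∈ U`.  [cite: MoeglinWaldspurger1995, II.1.7, IV.1.9–IV.1.11] [cite: KudlaRallis1994, §1] -/
theorem constTerm_sub_apply_mul_eq {U : Set ℂ} (hU : IsOpen U) (hUc : IsPreconnected U) {c : ℝ}
    (hne : (U ∩ {s : ℂ | c < s.re}).Nonempty) {C f M : ℂ → HA L e dV hdV dW hdW → ℂ} {a : ℂ → ℂ}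
    (hC : ∀ h, DifferentiableOn ℂ (fun s => C s h) U) (hf : ∀ h, DifferentiableOn ℂ (fun s => f s h) U) (ha : DifferentiableOn ℂ a U)
    (hdec : ∀ s ∈ U, c < s.re → ∀ h, C s h = a s * f s h + M s h)
    (m : HA L e dV hdV dW hdW) {κ : ℂ → ℂ} (hκ : DifferentiableOn ℂ κ U)
    (heig : ∀ s ∈ U, c < s.re → ∀ h, M s (m * h) = κ s * M s h) :
    ∀ s ∈ U, ∀ h, C s (m * h) - a s * f s (m * h) = κ s * (C s h - a s * f s h) := by
  refine apply_mul_eq_of_eqOn_halfPlane L e dV hdV dW hdW hU hUc hne (G := fun s h => C s h - a s * f s h)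
    (fun h => (hC h).sub (ha.mul (hf h))) m hκ ?_
  intro s hs hsc h
  simp only [hdec s hs hsc, add_sub_cancel_left]
  exact heig s hs hsc h

/-- **at the centre, cut (B)**: `C(0) = a(0)·f₀ + M⋆(0)` with `f₀(m h) = κ₁ f₀(h)` (★ section law of `f₀` at the scalar Levi element) and
`M⋆(0)(m h) = κ(0) M⋆(0)(h)` — the two ray-eigenfunctions fed to ★ S5-W4 ED. 2 (`eq_zero_of_centralRay_eigen`, two-eigenvalue form).
[cite: MoeglinWaldspurger1995, II.1.7] [cite: JiangWu2016ChiB, Prop. 4.1] -/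
theorem constTerm_centre_eq_add_of_rayEigen {U : Set ℂ} (hU : IsOpen U) (hUc : IsPreconnected U) {c : ℝ}
    (hne : (U ∩ {s : ℂ | c < s.re}).Nonempty) (h0 : (0 : ℂ) ∈ U) {C f M : ℂ → HA L e dV hdV dW hdW → ℂ} {a : ℂ → ℂ}
    (hC : ∀ h, DifferentiableOn ℂ (fun s => C s h) U) (hf : ∀ h, DifferentiableOn ℂ (fun s => f s h) U) (ha : DifferentiableOn ℂ a U)
    (hdec : ∀ s ∈ U, c < s.re → ∀ h, C s h = a s * f s h + M s h)
    (m : HA L e dV hdV dW hdW) {κ : ℂ → ℂ} (hκ : DifferentiableOn ℂ κ U)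
    (heig : ∀ s ∈ U, c < s.re → ∀ h, M s (m * h) = κ s * M s h) :
    (∀ h, C 0 h = a 0 * f 0 h + (C 0 h - a 0 * f 0 h)) ∧
      ∀ h, (C 0 (m * h) - a 0 * f 0 (m * h)) = κ 0 * (C 0 h - a 0 * f 0 h) :=
  ⟨fun h => by ring, constTerm_sub_apply_mul_eq L e dV hdV dW hdW hU hUc hne hC hf ha hdec m hκ heig 0 h0⟩

end Doubled

end Summit.HodgeConjecture.HodgeConjecture.Cruxes.HLiu418.K2LiuRankOneCentreContinuation

end
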